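import Mathlib
import HarnessLib

/-!
# Free canonical gas at `β·t = 8` — S3 (variance half): anti-concentration of a mode, `P(N = mode) ≥ 3 / (4(4σ + 3))`

Helper file for route `TcThermcert1` (crux K1′ `ThermalStiffnessCeilingU8b8_le_7o44`, item `stmt-Ventures-24560`), crux idea
`free-canonical-b8-rung` (stub S3 `stub_sectorWeight_at_mode` of `Cruxes/ThermalStiffnessCeilingU8b10_le_1o8/FreeCanonicalB8Sketch.lean`).

Stub S3 of the scheme lower-bounds the sector weight `P_r(N = N₀)` of the Poisson-binomial law of the free gas at a fugacity `r` making
`N₀` a MODE, by the Bobkov–Marsiglietti–Melbourne bound `max_k P(N = k) ≥ 1/√(1 + 12 Var N)` (CPC 30 (2021), Cor. 3.2). For the rung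
(an `∃ C` statement) any variance-only floor of order `1/σ` suffices, and the following ELEMENTARY one needs no literature: for every
finitely supported non-negative weight `w` on `ℕ`, every centre `μ` and every `σ ≥ 0` with `Σ_j (j − μ)² w_j ≤ σ² Σ_j w_j`
(Chebyshev data), a mode `M` of `w` carries at least the fraction `3/(4(4σ + 3))` of the mass:

  `3 · Σ_j w_j ≤ 4 (4σ + 3) · w_M`.

Proof: the window `|j − μ| < 2σ + 1` holds at least `3/4` of the mass (Chebyshev with threshold `2σ + 1 ≥ 1`, no case split at
`σ = 0`) and contains at most `4σ + 3` integers, each of weight `≤ w_M`. Combined with the tree's mode-existence half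
(`FreeGasArc.Inputs.exists_modeFugacity_pinned`, `Theorems/TcThermcert1FreeGasPinningInputs.lean`) and the Poisson-binomial variance
`σ_r² = Σ_k r a_k/(1 + r a_k)²` this is S3 with the constant `3/(4(4σ_r + 3))` in place of `1/√(1 + 12σ_r²)` — so the scheme carries NO
Literature debt at S3 (the BMM fact need not be filed).

HONEST LABEL: elementary finite probability; a step of a RUNG (`U = 0`, BC5-type witness for the C8 bet), reach at `U = 8` ZERO; decides
nothing about K1/K1′/`T_c`; superconductivity in the Hubbard model is NOT proved or advanced by this file beyond the rung.
-/

namespace Summit.Ventures.CertifiedManyBodySolver.Theorems.TcThermcert1.FreeCanonicalB8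

open Finset

/-- **Integers in a window.** A finite set of naturals all lying in the open window `|j − μ| < t` (`t ≥ 0`) has at most `2t + 1`
elements. -/
theorem card_le_of_abs_sub_lt (T : Finset ℕ) (μ t : ℝ) (ht : 0 ≤ t) (hT : ∀ j ∈ T, |(j : ℝ) - μ| < t) :
    (T.card : ℝ) ≤ 2 * t + 1 := by
  rcases T.eq_empty_or_nonempty with hTe | hTne
  · rw [hTe, Finset.card_empty, Nat.cast_zero]
    linarith
  · have hmin := hT _ (Finset.min'_mem T hTne)
    have hmax := hT _ (Finset.max'_mem T hTne)
    have hsub : T ⊆ Finset.Icc (T.min' hTne) (T.max' hTne) := fun j hj =>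
      Finset.mem_Icc.2 ⟨Finset.min'_le T j hj, Finset.le_max' T j hj⟩
    have hc : T.card ≤ T.max' hTne + 1 - T.min' hTne := (Finset.card_le_card hsub).trans_eq (Nat.card_Icc _ _)
    have hle : T.min' hTne ≤ T.max' hTne + 1 := (Finset.min'_le T _ (Finset.max'_mem T hTne)).trans (Nat.le_succ _)
    have hc' : (T.card : ℝ) ≤ (T.max' hTne : ℝ) + 1 - (T.min' hTne : ℝ) := by
      have := (Nat.cast_le (α := ℝ)).2 hc
      rw [Nat.cast_sub hle, Nat.cast_add, Nat.cast_one] at this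
      exact this
    have h1 := (abs_lt.1 hmin).1
    have h2 := (abs_lt.1 hmax).2
    linarith

/-- **Chebyshev tail bound for finitely supported weights.** With non-negative weights `w` on `s ⊆ ℕ`, any centre `μ`, and
`Σ (j − μ)² w_j ≤ σ² Σ w_j`, the mass outside the window `|j − μ| < 2σ + 1` is at most a quarter of the total. -/
theorem sum_filter_not_window_le (s : Finset ℕ) (w : ℕ → ℝ) (hw : ∀ j ∈ s, 0 ≤ w j) (μ σ : ℝ) (hσ : 0 ≤ σ)
    (hvar : ∑ j ∈ s, ((j : ℝ) - μ) ^ 2 * w j ≤ σ ^ 2 * ∑ j ∈ s, w j) :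
    ∑ j ∈ s.filter (fun j : ℕ => ¬ |(j : ℝ) - μ| < 2 * σ + 1), w j ≤ (∑ j ∈ s, w j) / 4 := by
  set t : ℝ := 2 * σ + 1 with ht
  have ht0 : 0 < t := by rw [ht]; linarith
  have h1 : ∑ j ∈ s.filter (fun j : ℕ => ¬ |(j : ℝ) - μ| < t), w j ≤
      ∑ j ∈ s.filter (fun j : ℕ => ¬ |(j : ℝ) - μ| < t), ((j : ℝ) - μ) ^ 2 * w j / t ^ 2 := by
    refine Finset.sum_le_sum fun j hj => ?_
    rw [Finset.mem_filter] at hj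
    have hjt : t ≤ |(j : ℝ) - μ| := not_lt.1 hj.2
    have hsq : t ^ 2 ≤ ((j : ℝ) - μ) ^ 2 := by
      rw [← sq_abs ((j : ℝ) - μ)]
      exact pow_le_pow_left₀ ht0.le hjt 2
    rw [le_div_iff₀ (by positivity)]
    calc w j * t ^ 2 ≤ w j * ((j : ℝ) - μ) ^ 2 := mul_le_mul_of_nonneg_left hsq (hw j hj.1)
      _ = ((j : ℝ) - μ) ^ 2 * w j := by ring
  have h2 : ∑ j ∈ s.filter (fun j : ℕ => ¬ |(j : ℝ) - μ| < t), ((j : ℝ) - μ) ^ 2 * w j / t ^ 2 ≤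
      ∑ j ∈ s, ((j : ℝ) - μ) ^ 2 * w j / t ^ 2 :=
    Finset.sum_le_sum_of_subset_of_nonneg (Finset.filter_subset _ _) fun j hj _ => by
      have := hw j hj
      positivity
  have h3 : ∑ j ∈ s, ((j : ℝ) - μ) ^ 2 * w j / t ^ 2 = (∑ j ∈ s, ((j : ℝ) - μ) ^ 2 * w j) / t ^ 2 := by
    rw [Finset.sum_div]
  have h4 : σ ^ 2 / t ^ 2 ≤ 1 / 4 := by
    rw [div_le_div_iff₀ (by positivity) (by norm_num), ht]
    nlinarith
  have hZ : 0 ≤ ∑ j ∈ s, w j := Finset.sum_nonneg hw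
  calc ∑ j ∈ s.filter (fun j : ℕ => ¬ |(j : ℝ) - μ| < t), w j
      ≤ (∑ j ∈ s, ((j : ℝ) - μ) ^ 2 * w j) / t ^ 2 := h1.trans (h2.trans h3.le)
    _ ≤ (σ ^ 2 * ∑ j ∈ s, w j) / t ^ 2 := div_le_div_of_nonneg_right hvar (by positivity)
    _ = σ ^ 2 / t ^ 2 * ∑ j ∈ s, w j := by ring
    _ ≤ 1 / 4 * ∑ j ∈ s, w j := mul_le_mul_of_nonneg_right h4 hZ
    _ = (∑ j ∈ s, w j) / 4 := by ring

/-- **Anti-concentration at a mode (variance-only floor).** For non-negative weights `w` on a finite `s ⊆ ℕ`, a mode `M`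
(`w_j ≤ w_M` on `s`, `w_M ≥ 0`), any centre `μ` and any `σ ≥ 0` with `Σ_{j∈s} (j − μ)² w_j ≤ σ² Σ_{j∈s} w_j`:
`3 Σ_{j∈s} w_j ≤ 4 (4σ + 3) w_M`, i.e. the normalised mode weight is at least `3 / (4(4σ + 3))`. (Replacement for the
Bobkov–Marsiglietti–Melbourne floor `1/√(1 + 12σ²)` in stub S3 of the crux idea `free-canonical-b8-rung`; for the rung's `∃ C` only
the order `1/σ` matters.) -/
theorem mode_weight_anticoncentration (s : Finset ℕ) (w : ℕ → ℝ) (hw : ∀ j ∈ s, 0 ≤ w j) {M : ℕ} (hM0 : 0 ≤ w M)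
    (hmode : ∀ j ∈ s, w j ≤ w M) (μ σ : ℝ) (hσ : 0 ≤ σ)
    (hvar : ∑ j ∈ s, ((j : ℝ) - μ) ^ 2 * w j ≤ σ ^ 2 * ∑ j ∈ s, w j) :
    3 * ∑ j ∈ s, w j ≤ 4 * (4 * σ + 3) * w M := by
  have hsplit : ∑ j ∈ s, w j =
      ∑ j ∈ s.filter (fun j : ℕ => |(j : ℝ) - μ| < 2 * σ + 1), w j +
        ∑ j ∈ s.filter (fun j : ℕ => ¬ |(j : ℝ) - μ| < 2 * σ + 1), w j :=
    (Finset.sum_filter_add_sum_filter_not s _ w).symm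
  have htail := sum_filter_not_window_le s w hw μ σ hσ hvar
  have hcard : ((s.filter (fun j : ℕ => |(j : ℝ) - μ| < 2 * σ + 1)).card : ℝ) ≤ 2 * (2 * σ + 1) + 1 :=
    card_le_of_abs_sub_lt _ μ (2 * σ + 1) (by linarith) fun j hj => (Finset.mem_filter.1 hj).2
  have hwin : ∑ j ∈ s.filter (fun j : ℕ => |(j : ℝ) - μ| < 2 * σ + 1), w j ≤ (4 * σ + 3) * w M := by
    calc ∑ j ∈ s.filter (fun j : ℕ => |(j : ℝ) - μ| < 2 * σ + 1), w j
        ≤ ∑ j ∈ s.filter (fun j : ℕ => |(j : ℝ) - μ| < 2 * σ + 1), w M :=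
          Finset.sum_le_sum fun j hj => hmode j (Finset.mem_filter.1 hj).1
      _ = ((s.filter (fun j : ℕ => |(j : ℝ) - μ| < 2 * σ + 1)).card : ℝ) * w M := by
          rw [Finset.sum_const, nsmul_eq_mul]
      _ ≤ (4 * σ + 3) * w M := mul_le_mul_of_nonneg_right (by linarith) hM0
  linarith

end Summit.Ventures.CertifiedManyBodySolver.Theorems.TcThermcert1.FreeCanonicalB8
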